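import Mathlib
import HarnessLib
import Literature.Analysis.FluidPDE.TaoCascadeNoLow
import Literature.Analysis.FluidPDE.Tao2016AveragedNS.LocalCascadeSolutions
import Literature.Analysis.FluidPDE.Tao2016AveragedNS.RenormalisedCascadeWaves
import Summits.NavierStokesRegularity.NavierStokesRegularity.Theorems.WakeRatchetMinimalViscousBlowupClosedValve
import Summits.NavierStokesRegularity.NavierStokesRegularity.Theorems.WakeRatchetMinimalViscousBlowupEveryShellFires
import Summits.NavierStokesRegularity.NavierStokesRegularity.Theorems.WakeRatchetMinimalViscousBlowupThresholdContinuity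

/-!
# Crux `TaoLadderRungTwoBreak.EternalRigidityViscBddOne` (stmt-NavierStokesRegularity-20420): under TYPE I a shell deep in the dissipation range
# is renormalised-small (part 1/2 of the UPPER CLOCK AT THE CRITICAL FRONT; part 2/2 = `…FrontClock`)

MODEL lattice ODEs only (Tao 2016 §4: the exact NS-scaled `ν`-viscous cascade lattice of a cancelling table with `|α_{··(0,0,1)}| ≤ 1`, `m = 4`);
nothing here is a statement about the Navier–Stokes equations; no stub, crux or summit is closed (`--supports stmt-NavierStokesRegularity-20420`).
Along a type-I trajectory (`Λ^k|X_{i,k}(t)|(T−t) ≤ C` on all shells) the renormalised energy `u_n = Λ^{2n}(T−t)²‖X_n‖²` of ONE shell obeys, in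
log-time `σ = −log(T−t)`, `du_n/dσ ≤ −2(1 + ν̂_n − 64DΛ⁻¹)u_n + 2P₀` (`D = 2C`, `P₀ = 64D²Λ(D+1)`, `ν̂_n = ν(1+ε₀)^{2n}(T−t)`; shell energy identity
`hasDerivWithinAt_blockEnergy` with both bond fluxes bounded through type I).  Hence `renormalisedSq_lt_of_deepDissipation`: there are `K₁, κ > 0`
(explicit in `C, c, Λ`) such that `ν̂_n(b) ≥ K₁` and `T − b ≤ κT` force `u_n(b) < c²` (fence `image_le_of_deriv_right_lt_deriv_boundary'` against the
log-time barrier `U(w) = p + δ + (D²+δ−p)((T−w)/(T−a))^{2r₀}`; `ν̂_n` decreases in time, so its value at the END of the window controls the window).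
HONEST LABEL: (ω3), (ω4), ⟨20420⟩ and every NS statement remain OPEN; rung 0.
-/
noncomputable section

-- the summit and its single sub-problem share the name (CONVENTIONS §1)
set_option linter.dupNamespace false

open Set Filter Topology
open Literature.Analysis.FluidPDE Literature.Analysis.FluidPDE.TaoCascade
open Summit.NavierStokesRegularity.NavierStokesRegularity.Theorems.MinimalViscousBlowup.ThresholdRay

namespace Summit.NavierStokesRegularity.NavierStokesRegularity.Theorems.EternalRigidityViscBddOne.DeepDissipation

/-- The barrier `U(w) = q + e·((T−w)/(T−a))^s` has derivative `−s·(U(w) − q)/(T − w)` at every `w < T` (`a < T`). [folklore] -/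
theorem hasDerivAt_barrier {T a q e s w : ℝ} (ha : a < T) (hw : w < T) :
    HasDerivAt (fun w => q + e * ((T - w) / (T - a)) ^ s)
      (-(s * (e * ((T - w) / (T - a)) ^ s) / (T - w))) w := by
  have hTa : 0 < T - a := by linarith
  have hTw : 0 < T - w := by linarith
  have hg : HasDerivAt (fun w => (T - w) / (T - a)) (-1 / (T - a)) w := by
    have h := ((hasDerivAt_id w).const_sub T).div_const (T - a)
    simpa using h
  have hgw : (T - w) / (T - a) ≠ 0 := (div_pos hTw hTa).ne'
  have hpow := hg.rpow_const (p := s) (Or.inl hgw)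
  have h2 := (hpow.const_mul e).const_add q
  refine h2.congr_deriv ?_
  rw [Real.rpow_sub_one hgw]
  field_simp

set_option maxHeartbeats 400000 in
/-- **Deep dissipation ⟹ small renormalised amplitude (clause form).**  `λ = 1+ε₀ > 1`, `ν ≥ 0`, a cancelling table with
`|α_{··(0,0,1)}| ≤ 1`, a regular trajectory of the `ν`-viscous lattice on `[0,T)` (`C¹` and the one-sided motion law — the clauses of
`ViscousUpTo`; no datum, energy or (4.5) bound is used) obeying the type-I bound `Λ^k|X_{i,k}(t)|(T−t) ≤ C` on all shells, and `0 < c ≤ 1`.  Then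
there are `K₁, κ > 0` (explicit in `C, c, Λ`) such that for every shell `n ≥ 0` and every `b ∈ [0,T)` with `T − b ≤ κT` and
`ν(1+ε₀)^{2n}(T−b) ≥ K₁`: `Λ^{2n}(T−b)²‖X_n(b)‖² < c²`.
[cite: Tao2016AveragedNS, §4 (4.3), proof of (4.13) (shell energy identity), (4.8), §6.4 (self-similar variables); Teschl2012, §2.6] -/
theorem renormalisedSq_lt_of_deepDissipation {ε₀ ν T C c : ℝ} (hε : 0 < ε₀) (hν : 0 ≤ ν) (hC : 0 ≤ C) (hc : 0 < c) (hc1 : c ≤ 1)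
    {α : Fin 4 → Fin 4 → Fin 4 → ℤ × ℤ × ℤ → ℝ} (hcan : IsCancellingCoeff α)
    (hα1 : ∀ i₁ i₂ i₃, |α i₁ i₂ i₃ (0, 0, 1)| ≤ 1) {X : Fin 4 → ℤ → ℝ → ℝ}
    (hcd : ∀ i n, ContDiffOn ℝ 1 (X i n) (Ico 0 T))
    (hmot : ∀ i n t, 0 ≤ t → t < T → derivWithin (X i n) (Ici 0) t =
      quadTerm ε₀ α X i n t - ν * (1 + ε₀) ^ ((2 : ℝ) * n) * X i n t)
    (hTI : ∀ t : ℝ, 0 ≤ t → t < T → ∀ (i : Fin 4) (k : ℤ), bigLam ε₀ ^ k * |X i k t| * (T - t) ≤ C) :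
    ∃ K₁ κ : ℝ, 0 < K₁ ∧ 0 < κ ∧ κ < 1 ∧ ∀ (n : ℕ) (b : ℝ), 0 ≤ b → b < T → T - b ≤ κ * T →
      K₁ ≤ ν * (1 + ε₀) ^ (2 * n) * (T - b) →
        bigLam ε₀ ^ (2 * n) * (T - b) ^ 2 * ‖shellVec X (n : ℤ) b‖ ^ 2 < c ^ 2 := by
  have hl0 : (0 : ℝ) < 1 + ε₀ := by linarith
  have hΛ : 0 < bigLam ε₀ := bigLam_pos (by linarith)
  set D : ℝ := 2 * C with hDdef
  have hD0 : 0 ≤ D := by rw [hDdef]; positivity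
  set P₀ : ℝ := 64 * D ^ 2 * bigLam ε₀ * (D + 1) with hP₀def
  have hP₀0 : 0 ≤ P₀ := by rw [hP₀def]; positivity
  set r₀ : ℝ := 4 * P₀ / c ^ 2 + 1 with hr₀def
  have hP4 : 0 ≤ 4 * P₀ / c ^ 2 := by positivity
  have hr₀1 : 1 ≤ r₀ := by rw [hr₀def]; linarith
  have hr₀0 : 0 < r₀ := by linarith
  set p : ℝ := P₀ / r₀ with hpdef
  have hp0 : 0 ≤ p := div_nonneg hP₀0 hr₀0.le
  have hpc : p ≤ c ^ 2 / 4 := by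
    rw [hpdef, div_le_iff₀ hr₀0, hr₀def]
    have hc2 : 0 < c ^ 2 := by positivity
    have : c ^ 2 / 4 * (4 * P₀ / c ^ 2 + 1) = P₀ + c ^ 2 / 4 := by field_simp
    rw [this]; linarith
  set δ : ℝ := c ^ 2 / 8 with hδdef
  have hδ0 : 0 < δ := by rw [hδdef]; positivity
  set K₁ : ℝ := 64 * D * (bigLam ε₀)⁻¹ + r₀ + 1 with hK₁def
  have hK₁0 : 0 < K₁ := by rw [hK₁def]; positivity
  set κ : ℝ := c ^ 2 / (4 * (D ^ 2 + 1)) with hκdef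
  have hκ0 : 0 < κ := by rw [hκdef]; positivity
  have hκ1 : κ < 1 := by
    rw [hκdef, div_lt_one (by positivity)]; nlinarith [sq_nonneg D]
  have hκD : (D ^ 2 + 1) * κ = c ^ 2 / 4 := by rw [hκdef]; field_simp
  have hrp : r₀ * p = P₀ := by rw [hpdef]; field_simp
  clear_value D P₀ r₀ p δ K₁ κ
  refine ⟨K₁, κ, hK₁0, hκ0, hκ1, fun n b hb0 hbT hwin hdeep => ?_⟩
  have hTb : 0 < T - b := by linarith
  set a : ℝ := T - (T - b) / κ with hadef
  have hTa : T - a = (T - b) / κ := by rw [hadef]; ring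
  have hTa0 : 0 < T - a := by rw [hTa]; positivity
  have ha0 : 0 ≤ a := by
    have : (T - b) / κ ≤ T := by rw [div_le_iff₀ hκ0]; linarith [mul_comm κ T]
    rw [hadef]; linarith
  have hab : a ≤ b := by
    have : T - b ≤ (T - b) / κ := by
      rw [le_div_iff₀ hκ0]; nlinarith
    rw [hadef]; linarith
  have haT : a < T := lt_of_le_of_lt hab hbT
  set T'' : ℝ := (b + T) / 2 with hT''
  have hbT'' : b < T'' := by rw [hT'']; linarith
  have hT''T : T'' < T := by rw [hT'']; linarith
  have hderW := hasDerivWithinAt_window_of_clauses (ε₀ := ε₀) (ν := ν) (α := α) hcd hmot hT''T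
  have hnormTI : ∀ w, 0 ≤ w → w < T → ∀ k : ℤ, ‖shellVec X k w‖ ≤ D / (bigLam ε₀ ^ k * (T - w)) := by
    intro w hw0 hwT k
    have hpos : 0 < bigLam ε₀ ^ k * (T - w) := mul_pos (zpow_pos hΛ _) (by linarith)
    have h2 : ∀ j : Fin 4, |X j k w| ≤ C / (bigLam ε₀ ^ k * (T - w)) := fun j => by
      rw [le_div_iff₀ hpos]
      calc |X j k w| * (bigLam ε₀ ^ k * (T - w)) = bigLam ε₀ ^ k * |X j k w| * (T - w) := by ring
        _ ≤ C := hTI w hw0 hwT j k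
    have h := norm_shellVec_le_two_mul (div_nonneg hC hpos.le) h2
    rw [hDdef]
    calc ‖shellVec X k w‖ ≤ 2 * (C / (bigLam ε₀ ^ k * (T - w))) := h
      _ = 2 * C / (bigLam ε₀ ^ k * (T - w)) := by ring
  obtain ⟨F, hF⟩ : ∃ F : ℝ → ℝ,
      F = fun w => ∑ k ∈ Finset.Ico n (n + 1), ∑ i : Fin 4, (1 / 2 : ℝ) * X i k w ^ 2 := ⟨_, rfl⟩
  have hFeq : ∀ w, F w = 1 / 2 * ‖shellVec X n w‖ ^ 2 := by
    intro w
    rw [hF]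
    simp only [Nat.Ico_succ_singleton, Finset.sum_singleton]
    rw [norm_shellVec_sq, Finset.mul_sum]
  obtain ⟨F', hF'⟩ : ∃ F' : ℝ → ℝ, F' = fun w => botSum ε₀ α X ((n : ℤ) - 1) w - botSum ε₀ α X (((n + 1 : ℕ) : ℤ) - 1) w -
      ν * ∑ k ∈ Finset.Ico n (n + 1), (1 + ε₀) ^ ((2 : ℝ) * (k : ℤ)) * ∑ i : Fin 4, X i k w ^ 2 := ⟨_, rfl⟩
  have hF'eq : ∀ w, F' w = botSum ε₀ α X ((n : ℤ) - 1) w - botSum ε₀ α X n w -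
      ν * (1 + ε₀) ^ (2 * n) * ‖shellVec X n w‖ ^ 2 := by
    intro w
    rw [hF']
    simp only [Nat.Ico_succ_singleton, Finset.sum_singleton]
    have hidx : (((n + 1 : ℕ) : ℤ) - 1) = (n : ℤ) := by push_cast; ring
    have hw2 : (1 + ε₀) ^ ((2 : ℝ) * ((n : ℕ) : ℤ)) = (1 + ε₀) ^ (2 * n) := by
      rw [show (2 : ℝ) * (((n : ℕ) : ℤ) : ℝ) = ((2 * n : ℕ) : ℝ) by push_cast; ring, Real.rpow_natCast]
    rw [hidx, hw2, norm_shellVec_sq]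
    ring
  have hXc : ∀ (i : Fin 4) (k : ℤ), ContinuousOn (X i k) (Icc a b) := fun i k =>
    (hcd i k).continuousOn.mono fun w hw => ⟨ha0.trans hw.1, lt_of_le_of_lt hw.2 hbT⟩
  have hFc : ContinuousOn F (Icc a b) := by
    rw [hF]
    exact continuousOn_finsetSum _ fun k _ => continuousOn_finsetSum _ fun i _ =>
      continuousOn_const.mul ((hXc i k).pow 2)
  have hFder : ∀ w ∈ Ico a b, HasDerivWithinAt F (F' w) (Ici w) w := by
    intro w hw
    have hw0 : 0 ≤ w := ha0.trans hw.1
    have hwT'' : w < T'' := lt_trans hw.2 hbT''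
    have h := hasDerivWithinAt_blockEnergy (ε₀ := ε₀) (ν := ν) hcan (fun i k => hderW i k w ⟨hw0, hwT''.le⟩) (Nat.le_succ n)
    rw [hF, hF']
    exact h.mono_of_mem_nhdsWithin (mem_of_superset (Icc_mem_nhdsGE hwT'') (Icc_subset_Icc hw0 le_rfl))
  set e : ℝ := D ^ 2 + δ - p with hedef
  set s : ℝ := 2 * r₀ with hsdef
  have hs1 : 1 ≤ s := by rw [hsdef]; linarith
  clear_value e s
  set U : ℝ → ℝ := fun w => (p + δ) + e * ((T - w) / (T - a)) ^ s with hUdef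
  set B : ℝ → ℝ := fun w => (1 / 2 : ℝ) * (bigLam ε₀ ^ (2 * n))⁻¹ * (U w * ((T - w) ^ 2)⁻¹) with hBdef
  clear_value U B
  have hUapply : ∀ w, U w = (p + δ) + e * ((T - w) / (T - a)) ^ s := fun w => by rw [hUdef]
  have hBapply : ∀ w, B w = (1 / 2 : ℝ) * (bigLam ε₀ ^ (2 * n))⁻¹ * (U w * ((T - w) ^ 2)⁻¹) := fun w => by
    rw [hBdef]
  have hΛn : 0 < bigLam ε₀ ^ (2 * n) := pow_pos hΛ _
  have hg01 : ∀ w, a ≤ w → w < T → 0 < (T - w) / (T - a) ∧ (T - w) / (T - a) ≤ 1 := fun w haw hwT =>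
    ⟨div_pos (by linarith) hTa0, by rw [div_le_one hTa0]; linarith⟩
  have hgs : ∀ w, a ≤ w → w < T → 0 < ((T - w) / (T - a)) ^ s ∧ ((T - w) / (T - a)) ^ s ≤ 1 := fun w haw hwT =>
    ⟨Real.rpow_pos_of_pos (hg01 w haw hwT).1 _, Real.rpow_le_one (hg01 w haw hwT).1.le (hg01 w haw hwT).2 (by linarith)⟩
  have hc2le : c ^ 2 ≤ 1 := pow_le_one₀ hc.le hc1
  have hD2 : 0 ≤ D ^ 2 := sq_nonneg D
  have hexpD : (D + 1) ^ 2 = D ^ 2 + 2 * D + 1 := by ring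
  have he_eq : e = D ^ 2 + δ - p := hedef
  have hUbounds : ∀ w, a ≤ w → w < T → δ ≤ U w ∧ U w ≤ (D + 1) ^ 2 := by
    intro w haw hwT
    obtain ⟨G, hG0, hG1, hUw⟩ : ∃ G : ℝ, 0 < G ∧ G ≤ 1 ∧ U w = p + δ + e * G :=
      ⟨_, (hgs w haw hwT).1, (hgs w haw hwT).2, hUapply w⟩
    rw [hUw]
    rcases le_or_gt 0 e with he | he
    · have h1 : 0 ≤ e * G := mul_nonneg he hG0.le
      have h2 : e * G ≤ e := mul_le_of_le_one_right he hG1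
      constructor
      · linarith
      · linarith
    · have h1 : e ≤ e * G := le_mul_of_le_one_right he.le hG1
      have h2 : e * G ≤ 0 := mul_nonpos_of_nonpos_of_nonneg he.le hG0.le
      constructor
      · linarith
      · linarith
  have hUder : ∀ w, w < T → HasDerivAt U (-(s * (e * ((T - w) / (T - a)) ^ s) / (T - w))) w := by
    intro w hwT
    rw [hUdef]
    exact hasDerivAt_barrier haT hwT
  have hBder : ∀ w, w < T → HasDerivAt B
      ((1 / 2 : ℝ) * (bigLam ε₀ ^ (2 * n))⁻¹ *
        (-(s * (e * ((T - w) / (T - a)) ^ s) / (T - w)) * ((T - w) ^ 2)⁻¹ +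
          U w * (2 / (T - w) ^ 3))) w := by
    intro w hwT
    have hTw : 0 < T - w := by linarith
    have hsq : HasDerivAt (fun w => (T - w) ^ 2) (((2 : ℕ) : ℝ) * (T - w) ^ (2 - 1) * (-1)) w :=
      ((hasDerivAt_id' w).const_sub T).fun_pow 2
    have hinv : HasDerivAt (fun w => ((T - w) ^ 2)⁻¹)
        (-(((2 : ℕ) : ℝ) * (T - w) ^ (2 - 1) * (-1)) / ((T - w) ^ 2) ^ 2) w :=
      hsq.inv (pow_ne_zero 2 hTw.ne')
    have hprod := ((hUder w hwT).fun_mul hinv).const_mul ((1 / 2 : ℝ) * (bigLam ε₀ ^ (2 * n))⁻¹)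
    have hBfun : B = fun w => (1 / 2 : ℝ) * (bigLam ε₀ ^ (2 * n))⁻¹ * (U w * ((T - w) ^ 2)⁻¹) := hBdef
    rw [hBfun]
    refine hprod.congr_deriv ?_
    have hTw' : (T - w) ≠ 0 := hTw.ne'
    simp only [Nat.cast_ofNat]
    field_simp
    ring
  have hBcont : ContinuousOn B (Icc a b) := fun w hw =>
    ((hBder w (lt_of_le_of_lt hw.2 hbT)).continuousAt).continuousWithinAt
  have hBd : ∀ w ∈ Ico a b, HasDerivWithinAt B _ (Ici w) w := fun w hw =>
    (hBder w (lt_trans hw.2 hbT)).hasDerivWithinAt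
  have hz : bigLam ε₀ ^ (2 * n) = (bigLam ε₀ ^ (n : ℤ)) ^ 2 := by
    rw [zpow_natCast, ← pow_mul, mul_comm]
  have hΛnz : 0 < bigLam ε₀ ^ (n : ℤ) := zpow_pos hΛ _
  have hstart : F a ≤ B a := by
    rw [hFeq a, hBapply a, hUapply a]
    have hga : (T - a) / (T - a) = 1 := div_self hTa0.ne'
    rw [hga, Real.one_rpow, mul_one]
    have hXa := hnormTI a ha0 haT n
    have hpos : 0 < bigLam ε₀ ^ (n : ℤ) * (T - a) := mul_pos hΛnz hTa0
    have hsq : ‖shellVec X n a‖ ^ 2 ≤ (D / (bigLam ε₀ ^ (n : ℤ) * (T - a))) ^ 2 :=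
      pow_le_pow_left₀ (norm_nonneg _) hXa 2
    have hrhs : (1 / 2 : ℝ) * (bigLam ε₀ ^ (2 * n))⁻¹ * ((p + δ + e) * ((T - a) ^ 2)⁻¹) =
        (1 / 2 : ℝ) * ((D ^ 2 + 2 * δ) / (bigLam ε₀ ^ (n : ℤ) * (T - a)) ^ 2) := by
      rw [he_eq, hz]
      have hTa' : (T - a) ≠ 0 := hTa0.ne'
      have hΛn' : bigLam ε₀ ^ (n : ℤ) ≠ 0 := hΛnz.ne'
      field_simp
      ring
    rw [hrhs]
    have hmono : (D / (bigLam ε₀ ^ (n : ℤ) * (T - a))) ^ 2 ≤ (D ^ 2 + 2 * δ) / (bigLam ε₀ ^ (n : ℤ) * (T - a)) ^ 2 := by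
      rw [div_pow]
      exact div_le_div_of_nonneg_right (by linarith) (by positivity)
    linarith
  have hbound : ∀ w ∈ Ico a b, F w = B w → F' w <
      (1 / 2 : ℝ) * (bigLam ε₀ ^ (2 * n))⁻¹ *
        (-(s * (e * ((T - w) / (T - a)) ^ s) / (T - w)) * ((T - w) ^ 2)⁻¹ + U w * (2 / (T - w) ^ 3)) := by
    intro w hw hFB
    have hw0 : 0 ≤ w := ha0.trans hw.1
    have hwT : w < T := lt_trans hw.2 hbT
    have hTw : 0 < T - w := by linarith
    obtain ⟨hUlo, hUhi⟩ := hUbounds w hw.1 hwT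
    have hUpos : 0 < U w := lt_of_lt_of_le hδ0 hUlo
    have hy : ‖shellVec X n w‖ ^ 2 = U w * ((bigLam ε₀ ^ (2 * n))⁻¹ * ((T - w) ^ 2)⁻¹) := by
      have := hFeq w
      rw [hFB, hBapply w] at this
      linarith
    have hynn : 0 ≤ ‖shellVec X n w‖ := norm_nonneg _
    have hyle : ‖shellVec X n w‖ ≤ (D + 1) / (bigLam ε₀ ^ (n : ℤ) * (T - w)) := by
      have h1 : ‖shellVec X n w‖ ^ 2 ≤ ((D + 1) / (bigLam ε₀ ^ (n : ℤ) * (T - w))) ^ 2 := by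
        rw [hy, hz, div_pow, mul_pow]
        have : U w * ((((bigLam ε₀ ^ (n : ℤ)) ^ 2))⁻¹ * ((T - w) ^ 2)⁻¹) = U w / ((bigLam ε₀ ^ (n : ℤ)) ^ 2 * (T - w) ^ 2) := by
          field_simp
        rw [this]
        exact div_le_div_of_nonneg_right hUhi (by positivity)
      exact (pow_le_pow_iff_left₀ hynn (by positivity) two_ne_zero).1 h1
    have hin : |botSum ε₀ α X ((n : ℤ) - 1) w| ≤ P₀ *
        ((bigLam ε₀ ^ (2 * n))⁻¹ * ((T - w) ^ 3)⁻¹) := by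
      have hb := abs_botSum_le_norm_shellVec hl0 hα1 X ((n : ℤ) - 1) w
      have hP : (1 + ε₀) ^ ((5 : ℝ) * (((n : ℤ) - 1 : ℤ) : ℝ) / 2) = bigLam ε₀ ^ ((n : ℤ) - 1) := by
        rw [bigLam, ← Real.rpow_intCast, ← Real.rpow_mul hl0.le]
        congr 1
        push_cast
        ring
      have hsub : ((n : ℤ) - 1 + 1) = (n : ℤ) := by ring
      have hXm := hnormTI w hw0 hwT ((n : ℤ) - 1)
      have hΛm : 0 < bigLam ε₀ ^ ((n : ℤ) - 1) := zpow_pos hΛ _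
      have hzm : bigLam ε₀ ^ ((n : ℤ) - 1) = bigLam ε₀ ^ (n : ℤ) * (bigLam ε₀)⁻¹ := by
        rw [zpow_sub_one₀ hΛ.ne']
      calc |botSum ε₀ α X ((n : ℤ) - 1) w|
          ≤ (4 : ℝ) ^ 3 * (1 + ε₀) ^ ((5 : ℝ) * (((n : ℤ) - 1 : ℤ) : ℝ) / 2) * ‖shellVec X ((n : ℤ) - 1) w‖ ^ 2 *
              ‖shellVec X ((n : ℤ) - 1 + 1) w‖ := by exact_mod_cast hb
        _ ≤ (4 : ℝ) ^ 3 * bigLam ε₀ ^ ((n : ℤ) - 1) * (D / (bigLam ε₀ ^ ((n : ℤ) - 1) * (T - w))) ^ 2 *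
              ((D + 1) / (bigLam ε₀ ^ (n : ℤ) * (T - w))) := by
            rw [hP, hsub]
            exact mul_le_mul (mul_le_mul_of_nonneg_left (pow_le_pow_left₀ (norm_nonneg _) hXm 2) (by positivity))
              hyle hynn (by positivity)
        _ = P₀ * ((bigLam ε₀ ^ (2 * n))⁻¹ * ((T - w) ^ 3)⁻¹) := by
            rw [hz, hzm, hP₀def]
            field_simp
            ring
    have hout : |botSum ε₀ α X (n : ℤ) w| ≤ 64 * D * (bigLam ε₀)⁻¹ * U w *
        ((bigLam ε₀ ^ (2 * n))⁻¹ * ((T - w) ^ 3)⁻¹) := by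
      have hb := abs_botSum_le_norm_shellVec hl0 hα1 X (n : ℤ) w
      have hP : (1 + ε₀) ^ ((5 : ℝ) * ((n : ℕ) : ℤ) / 2) = bigLam ε₀ ^ (n : ℤ) := by
        rw [bigLam, ← Real.rpow_intCast, ← Real.rpow_mul hl0.le]
        congr 1
        push_cast
        ring
      have hXp := hnormTI w hw0 hwT ((n : ℤ) + 1)
      have hzp : bigLam ε₀ ^ ((n : ℤ) + 1) = bigLam ε₀ ^ (n : ℤ) * bigLam ε₀ := zpow_add_one₀ hΛ.ne' _
      calc |botSum ε₀ α X (n : ℤ) w|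
          ≤ (4 : ℝ) ^ 3 * (1 + ε₀) ^ ((5 : ℝ) * ((n : ℕ) : ℤ) / 2) * ‖shellVec X (n : ℤ) w‖ ^ 2 *
              ‖shellVec X ((n : ℤ) + 1) w‖ := by exact_mod_cast hb
        _ ≤ (4 : ℝ) ^ 3 * bigLam ε₀ ^ (n : ℤ) * ‖shellVec X (n : ℤ) w‖ ^ 2 *
              (D / (bigLam ε₀ ^ ((n : ℤ) + 1) * (T - w))) := by
            rw [hP]
            exact mul_le_mul_of_nonneg_left hXp (by positivity)
        _ = 64 * D * (bigLam ε₀)⁻¹ * U w * ((bigLam ε₀ ^ (2 * n))⁻¹ * ((T - w) ^ 3)⁻¹) := by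
            rw [hy, hz, hzp]
            field_simp
            ring
    have hvisc : K₁ ≤ ν * (1 + ε₀) ^ (2 * n) * (T - w) := by
      have : ν * (1 + ε₀) ^ (2 * n) * (T - b) ≤ ν * (1 + ε₀) ^ (2 * n) * (T - w) :=
        mul_le_mul_of_nonneg_left (by linarith [hw.2]) (mul_nonneg hν (pow_nonneg hl0.le _))
      linarith
    have hdis : ν * (1 + ε₀) ^ (2 * n) * ‖shellVec X n w‖ ^ 2 =
        (ν * (1 + ε₀) ^ (2 * n) * (T - w)) * U w * ((bigLam ε₀ ^ (2 * n))⁻¹ * ((T - w) ^ 3)⁻¹) := by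
      rw [hy]
      have hTw' : (T - w) ≠ 0 := hTw.ne'
      have h3 : ((T - w) ^ 3)⁻¹ = ((T - w) ^ 2)⁻¹ * (T - w)⁻¹ := by
        rw [← mul_inv, pow_succ]
      rw [h3]
      field_simp
    set Q : ℝ := (bigLam ε₀ ^ (2 * n))⁻¹ * ((T - w) ^ 3)⁻¹ with hQdef
    have hQ : 0 < Q := by rw [hQdef]; positivity
    have e1 : botSum ε₀ α X ((n : ℤ) - 1) w ≤ P₀ * Q := (le_abs_self _).trans hin
    have e2 : -botSum ε₀ α X (n : ℤ) w ≤ 64 * D * (bigLam ε₀)⁻¹ * U w * Q := (neg_le_abs _).trans hout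
    clear_value Q
    have hF'le : F' w ≤ (P₀ + 64 * D * (bigLam ε₀)⁻¹ * U w - (ν * (1 + ε₀) ^ (2 * n) * (T - w)) * U w) * Q := by
      rw [hF'eq w, hdis]
      have hexp : (P₀ + 64 * D * (bigLam ε₀)⁻¹ * U w - (ν * (1 + ε₀) ^ (2 * n) * (T - w)) * U w) * Q =
          P₀ * Q + 64 * D * (bigLam ε₀)⁻¹ * U w * Q - (ν * (1 + ε₀) ^ (2 * n) * (T - w)) * U w * Q := by ring
      rw [hexp]
      linarith
    have hB'eq : (1 / 2 : ℝ) * (bigLam ε₀ ^ (2 * n))⁻¹ *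
        (-(s * (e * ((T - w) / (T - a)) ^ s) / (T - w)) * ((T - w) ^ 2)⁻¹ + U w * (2 / (T - w) ^ 3)) =
        (-(r₀ * (U w - (p + δ))) + U w) * Q := by
      have hUw : e * ((T - w) / (T - a)) ^ s = U w - (p + δ) := by rw [hUapply w]; ring
      have hTw' : (T - w) ≠ 0 := hTw.ne'
      have hΛ2 : bigLam ε₀ ^ (2 * n) ≠ 0 := hΛn.ne'
      rw [hUw, hQdef, hsdef]
      field_simp
    rw [hB'eq]
    refine lt_of_le_of_lt hF'le (mul_lt_mul_of_pos_right ?_ hQ)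
    have hcoef0 : 64 * D * (bigLam ε₀)⁻¹ - ν * (1 + ε₀) ^ (2 * n) * (T - w) ≤ -(r₀ + 1) := by
      rw [hK₁def] at hvisc; linarith
    have hcoef : (64 * D * (bigLam ε₀)⁻¹ - ν * (1 + ε₀) ^ (2 * n) * (T - w)) * U w ≤ -(r₀ + 1) * U w :=
      mul_le_mul_of_nonneg_right hcoef0 hUpos.le
    have hexp2 : -(r₀ * (U w - (p + δ))) + U w = -(r₀ + 1) * U w + 2 * U w + r₀ * p + r₀ * δ := by ring
    have hexp3 : P₀ + 64 * D * (bigLam ε₀)⁻¹ * U w - ν * (1 + ε₀) ^ (2 * n) * (T - w) * U w =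
        P₀ + (64 * D * (bigLam ε₀)⁻¹ - ν * (1 + ε₀) ^ (2 * n) * (T - w)) * U w := by ring
    rw [hexp2, hexp3, hrp]
    have hrδ : 0 < r₀ * δ := mul_pos hr₀0 hδ0
    linarith only [hcoef, hUpos, hrδ]
  have hfence := image_le_of_deriv_right_lt_deriv_boundary' hFc hFder hstart hBcont hBd hbound
    (right_mem_Icc.2 hab)
  have hUb : U b < c ^ 2 := by
    obtain ⟨hg0, hg1⟩ := hgs b hab hbT
    have hgb : ((T - b) / (T - a)) ^ s ≤ κ := by
      have hbase : (T - b) / (T - a) = κ := by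
        rw [hTa]; field_simp
      rw [hbase]
      calc κ ^ s ≤ κ ^ (1 : ℝ) := Real.rpow_le_rpow_of_exponent_ge hκ0 hκ1.le hs1
        _ = κ := Real.rpow_one κ
    obtain ⟨G, hG0, hGκ, hUb'⟩ : ∃ G : ℝ, 0 < G ∧ G ≤ κ ∧ U b = p + δ + e * G := ⟨_, hg0, hgb, hUapply b⟩
    rw [hUb']
    have hc2 : 0 < c ^ 2 := by positivity
    have hδval : δ = c ^ 2 / 8 := hδdef
    have hδp : p + δ ≤ c ^ 2 / 4 + c ^ 2 / 8 := by rw [hδval]; exact add_le_add_left hpc _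
    rcases le_or_gt 0 e with he | he
    · have h1 : e * G ≤ e * κ := mul_le_mul_of_nonneg_left hGκ he
      have he1 : e ≤ D ^ 2 + 1 := by
        rw [he_eq, hδval]
        have : c ^ 2 / 8 - p ≤ 1 := by
          have := sub_le_self (c ^ 2 / 8) hp0
          exact this.trans (by linarith only [hc2le])
        linarith only [this]
      have h2 : e * κ ≤ (D ^ 2 + 1) * κ := mul_le_mul_of_nonneg_right he1 hκ0.le
      have h3 : e * G ≤ c ^ 2 / 4 := (h1.trans h2).trans hκD.le
      calc p + δ + e * G ≤ (c ^ 2 / 4 + c ^ 2 / 8) + c ^ 2 / 4 := add_le_add hδp h3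
        _ < c ^ 2 := by linarith only [hc2]
    · have h1 : e * G ≤ 0 := mul_nonpos_of_nonpos_of_nonneg he.le hG0.le
      calc p + δ + e * G ≤ (c ^ 2 / 4 + c ^ 2 / 8) + 0 := add_le_add hδp h1
        _ < c ^ 2 := by linarith only [hc2]
  have hFb : F b ≤ B b := hfence
  rw [hFeq b, hBapply b] at hFb
  have hTb2 : 0 < (T - b) ^ 2 := by positivity
  have hkey : bigLam ε₀ ^ (2 * n) * (T - b) ^ 2 * ‖shellVec X (n : ℤ) b‖ ^ 2 ≤ U b := by
    have h1 : ‖shellVec X (n : ℤ) b‖ ^ 2 ≤ (bigLam ε₀ ^ (2 * n))⁻¹ * (U b * ((T - b) ^ 2)⁻¹) := by linarith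
    have h2 := mul_le_mul_of_nonneg_left h1 (mul_pos hΛn hTb2).le
    have h3 : bigLam ε₀ ^ (2 * n) * (T - b) ^ 2 * ((bigLam ε₀ ^ (2 * n))⁻¹ * (U b * ((T - b) ^ 2)⁻¹)) = U b := by
      field_simp
    calc bigLam ε₀ ^ (2 * n) * (T - b) ^ 2 * ‖shellVec X (n : ℤ) b‖ ^ 2
        ≤ bigLam ε₀ ^ (2 * n) * (T - b) ^ 2 * ((bigLam ε₀ ^ (2 * n))⁻¹ * (U b * ((T - b) ^ 2)⁻¹)) := h2
      _ = U b := h3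
  exact lt_of_le_of_lt hkey hUb

end Summit.NavierStokesRegularity.NavierStokesRegularity.Theorems.EternalRigidityViscBddOne.DeepDissipation

end
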